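import Summits.KontsevichZagierPeriods.Zeta5Search.Certificates.RayC1KernelPeriodicTable
import Summits.KontsevichZagierPeriods.Zeta5Search.Certificates.RayC1KernelClassTable
import HarnessLib

/-!
# ζ(5) search — certificates: a window table above `θ = 1/m₁` PLUS a PERIODIC table below it, consumed at every shift — the exponent (CERT-1 g6)

HONEST FRAMING: systematic search; no irrationality claim unless certified.  Valuation bookkeeping of explicit rationals and
prime-number-theorem rates; every exponent this file yields in the cell is `< 1` — a calibration of the T1-map ray C1 (λ* = 108.2193 is
the certified tie; no crossing claimed), nothing about the arithmetic nature of `ζ(5)`.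

OUR work (Summit side; cert-1 seat, generation 6; consumer side of the lead's (S2), agreed with typer g17 INBOX 2026-08-21T23:33Z/23:4xZ).
Sequel of `RayC1KernelPeriodicTable` (periodic entries, `PSound`) and of typer g17's `RayC1KernelClassTable` (`kMT tab n = kM0 n/(Φ_K Φ_tab)`).
THE RULE: the window table `tab` lives above `θ = 1/m₁` (`headGE m₁ tab`, one `decide`), the periodic table `ptab` lists `ω`-cells
`[u, v) ⊆ (0, 1]` and is consumed at EVERY shift `m₁ ≤ m ≤ Kp(n)` by ONE truncated periodic step factor (`Hata1992.stepFactorTrunc`) — so no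
prime is counted twice and nothing below `θ = 1/m₁` needs a row per shift:
* `perFactor ptab m₁ n`, `perRate ptab m₁ = Σ_e w_e·S(u_e, v_e, m₁)` (`S = fracRate`), `eventually_exp_le_perFactor` (growing cut-off), the
  certified rational minorant `pterm m₁ e = w·(v−u)/(m₁ − 1/2 + 1/(8m₁) + (u+v)/2)` (`perRate_ge_listSum` via `fracRate_ge_sharp`; `prate_append`
  for tables in parts);
* the combined atlas over `(Fin 4 ⊕ Fin tab.length) ⊕ (Fin ptab.length × shifts)` (`corrP_eq`), pairwise disjoint (`yS_disjoint`: `chainOK ptab`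
  sorts the cells; shifts nest; `headGE` separates the table), hence **`kMP_ints`** by ONE `RayKernel.atlas_ints`
  (`kMP tab ptab m₁ n = kMT tab n / perFactor ptab m₁ n`), `eventually_kMP_le_exp` (rate `359.4247 − R − perRate`);
* **`c1_exponent_of_tables`** — for a sound window checker and a sound periodic checker (`psound_brick`, `psound_class` under fam-rv's
  `∀ c ∈ pw, PWin.Holds c`, `psound_or`), `chainOK` on both tables, `headGE m₁ tab`, rates `R` (windows) and `Rp ≤ Σ pterm` (periodic):
  every `γ ≥ 0` with `γ·((359.4247 − R − Rp + 0.01) + c_u) < c_l − ℓ` is an effective exponent.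
USES: `m₁ = 16` with the 772 brick cells reproduces typer's uniform tail; `m₁ = 4` keeps `c1Low` and replaces `c1Deep*`; `m₁ = 1` makes the whole
region below `θ = 1` periodic (bricks + fam-rv/fam-denom periodic class cells as they are certified) — the consumer of the "θ ≤ 1 period".
-/

noncomputable section

open Finset Real Filter Topology

namespace Summit.KontsevichZagierPeriods.Zeta5Search.RayC1

open Summit.KontsevichZagierPeriods.Zeta5Search.DualSeries
open Summit.KontsevichZagierPeriods.Zeta5Search.DualSeriesDenominators
open Summit.KontsevichZagierPeriods.Zeta5Search.WedgeDictionary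
open Summit.KontsevichZagierPeriods.Zeta5Search.RayKernel
open Literature.NumberTheory.Irrationality.Hata1992
open Literature.NumberTheory.Transcendental (zetaValue)
open Summit.KontsevichZagierPeriods.Zeta5Search.RayH1 (windowPrimes_disjoint_of_le)

/-! ### The head check with the cut `θ = 1/m₁` -/

/-- The head check: the first window of the table starts at `A ≥ 1/m₁` (then all do, by `chainOK`). -/
def headGE (m₁ : ℕ) : List WinEntry → Bool
  | [] => true
  | e :: _ => decide ((1 : ℚ) / m₁ ≤ e.1)

variable {tab ptab : List WinEntry} {m₁ : ℕ}

/-- Under `chainOK`, the head check bounds EVERY left endpoint: `1/m₁ ≤ A_t`. -/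
theorem tA_ge_of_headGE (hchain : chainOK tab = true) (hhead : headGE m₁ tab = true) (t : Fin tab.length) :
    (1 : ℚ) / m₁ ≤ tA tab t := by
  have h0 := chainOK_head_le hchain (t : ℕ) t.isLt
  unfold tA
  refine le_trans ?_ h0
  cases tab with
  | nil => exact t.elim0
  | cons e rest => simpa [headGE] using hhead

/-! ### The periodic table as a step function, its factor and its rate -/

variable (ptab m₁)

/-- Left endpoint `u` of periodic entry `i`, real. -/
def peU (i : Fin ptab.length) : ℝ := (((ptab[(i : ℕ)]).1 : ℚ) : ℝ)

/-- Right endpoint `v` of periodic entry `i`, real. -/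
def peV (i : Fin ptab.length) : ℝ := (((ptab[(i : ℕ)]).2.1 : ℚ) : ℝ)

/-- Weight `w` of periodic entry `i`. -/
def peW (i : Fin ptab.length) : ℕ := (ptab[(i : ℕ)]).2.2.1

/-- **The periodic factor**: the truncated step factor of the table's step function over the shifts `m₁ ≤ m ≤ Kp(n)`. -/
def perFactor (n : ℕ) : ℕ := stepFactorTrunc (Finset.univ : Finset (Fin ptab.length)) (peU ptab) (peV ptab) (peW ptab) m₁ (Kp n) n

/-- **The periodic rate** `Σ_e w_e·S(u_e, v_e, m₁)` (`S(u,v,m₁) = ψ(m₁+v) − ψ(m₁+u)`). -/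
def perRate : ℝ := ∑ i : Fin ptab.length, (peW ptab i : ℝ) * fracRate (peU ptab i) (peV ptab i) m₁

/-- The certified rational minorant of one entry's rate: `w·(v−u)/(m₁ − 1/2 + 1/(8m₁) + (u+v)/2)`. -/
def pterm (e : WinEntry) : ℚ :=
  (e.2.2.1 : ℚ) * ((e.2.1 - e.1) / ((m₁ : ℚ) - 1 / 2 + 1 / (8 * (m₁ : ℚ)) + (e.1 + e.2.1) / 2))

variable {ptab m₁}

/-- `0 < perFactor`. -/
theorem perFactor_pos (n : ℕ) : 0 < perFactor ptab m₁ n := stepFactorTrunc_pos _ _ _ _ _ _ _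

/-- The cells of a sound periodic table satisfy the step-factor hypotheses `0 < u < v ≤ 1`. -/
theorem pe_hyp {ok : WinEntry → Bool} {NT : ℕ} (hps : PSound ok NT) (hpok : ptab.all ok = true) :
    ∀ i ∈ (Finset.univ : Finset (Fin ptab.length)), 0 < peU ptab i ∧ peU ptab i < peV ptab i ∧ peV ptab i ≤ 1 := by
  intro i _
  obtain ⟨⟨h1, h2, h3⟩, -⟩ := hps _ (getElem_all hpok (i : ℕ) i.isLt)
  unfold peU peV
  exact ⟨by exact_mod_cast h1, by exact_mod_cast h2, by exact_mod_cast h3⟩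

/-- The rate of a periodic table in parts. -/
theorem prate_append (m₁ : ℕ) (l₁ l₂ : List WinEntry) :
    ((l₁ ++ l₂).map (pterm m₁)).sum = (l₁.map (pterm m₁)).sum + (l₂.map (pterm m₁)).sum := by
  rw [List.map_append, List.sum_append]

/-- **The certified minorant of the periodic rate**: `Σ_e pterm m₁ e ≤ perRate ptab m₁` for a sound table and `m₁ ≥ 1`. -/
theorem perRate_ge_listSum {ok : WinEntry → Bool} {NT : ℕ} (hps : PSound ok NT) (hpok : ptab.all ok = true) (hm₁ : 1 ≤ m₁) :
    (((ptab.map (pterm m₁)).sum : ℚ) : ℝ) ≤ perRate ptab m₁ := by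
  rw [← sum_fin_getElem_eq_map_sum, Rat.cast_sum]
  unfold perRate
  refine sum_le_sum fun i hi => ?_
  obtain ⟨hu, huv, -⟩ := pe_hyp hps hpok i hi
  have hb := fracRate_ge_sharp hu huv.le hm₁
  have hcast : ((pterm m₁ (ptab[(i : ℕ)]) : ℚ) : ℝ) =
      (peW ptab i : ℝ) * ((peV ptab i - peU ptab i) / ((m₁ : ℝ) - 1 / 2 + 1 / (8 * m₁) + (peU ptab i + peV ptab i) / 2)) := by
    unfold pterm peU peV peW; push_cast; ring
  rw [hcast]
  exact mul_le_mul_of_nonneg_left hb (Nat.cast_nonneg _)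

/-- The periodic factor grows (by divisibility) with the cut-off. -/
theorem perFactor_dvd_of_le {K K' : ℕ} (h : K ≤ K') (n : ℕ) :
    stepFactorTrunc (Finset.univ : Finset (Fin ptab.length)) (peU ptab) (peV ptab) (peW ptab) m₁ K n ∣
      stepFactorTrunc (Finset.univ : Finset (Fin ptab.length)) (peU ptab) (peV ptab) (peW ptab) m₁ K' n :=
  Finset.prod_dvd_prod_of_dvd _ _ fun i _ =>
    pow_dvd_pow_of_dvd (Finset.prod_dvd_prod_of_subset _ _ _ (Finset.Ico_subset_Ico_right (by omega))) _

/-- **Size of the periodic factor**: for every `ε > 0`, eventually `e^{(perRate − ε)·n} ≤ perFactor n` (`exists_trunc_eventually_exp_le` with a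
fixed cut-off, monotonicity, `Kp(n) → ∞`). -/
theorem eventually_exp_le_perFactor {ok : WinEntry → Bool} {NT : ℕ} (hps : PSound ok NT) (hpok : ptab.all ok = true) {ε : ℝ} (hε : 0 < ε) :
    ∀ᶠ n : ℕ in atTop, Real.exp ((perRate ptab m₁ - ε) * n) ≤ (perFactor ptab m₁ n : ℕ) := by
  obtain ⟨K₀, hK₀⟩ := exists_trunc_eventually_exp_le (c := peW ptab) (pe_hyp hps hpok) m₁ hε
  filter_upwards [hK₀, tendsto_Kp.eventually (eventually_ge_atTop K₀)] with n hn hKn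
  refine hn.trans ?_
  unfold perFactor
  exact_mod_cast Nat.le_of_dvd (stepFactorTrunc_pos _ _ _ _ _ _ _) (perFactor_dvd_of_le hKn n)

/-! ### The periodic windows are pairwise disjoint and lie below `θ = 1/m₁` -/

/-- The windows of two (entry, shift) pairs of a chained sound periodic table are disjoint. -/
theorem perWin_disjoint {ok : WinEntry → Bool} {NT : ℕ} (hps : PSound ok NT) (hpok : ptab.all ok = true)
    (hpchain : chainOK ptab = true) {i j : Fin ptab.length} {m m' : ℕ} (hne : (i, m) ≠ (j, m')) (n : ℕ) :
    Disjoint (windowPrimes (1 / ((m : ℝ) + peV ptab i)) (1 / ((m : ℝ) + peU ptab i)) n)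
      (windowPrimes (1 / ((m' : ℝ) + peV ptab j)) (1 / ((m' : ℝ) + peU ptab j)) n) := by
  obtain ⟨hui, huvi, hvi⟩ := pe_hyp hps hpok i (Finset.mem_univ _)
  obtain ⟨huj, huvj, hvj⟩ := pe_hyp hps hpok j (Finset.mem_univ _)
  have hm0 : (0 : ℝ) ≤ m := Nat.cast_nonneg m
  have hm0' : (0 : ℝ) ≤ m' := Nat.cast_nonneg m'
  have hVi : 0 < (m : ℝ) + peV ptab i := by linarith
  have hVj : 0 < (m' : ℝ) + peV ptab j := by linarith
  have hAi : (0 : ℝ) ≤ 1 / ((m : ℝ) + peV ptab i) := (one_div_pos.2 hVi).le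
  have hAj : (0 : ℝ) ≤ 1 / ((m' : ℝ) + peV ptab j) := (one_div_pos.2 hVj).le
  rcases lt_trichotomy m m' with hlt | heq | hgt
  · have h1 : (m : ℝ) + 1 ≤ m' := by exact_mod_cast hlt
    have h : 1 / ((m' : ℝ) + peU ptab j) ≤ 1 / ((m : ℝ) + peV ptab i) := one_div_le_one_div_of_le hVi (by linarith)
    exact (windowPrimes_disjoint_of_le hAj hAi h n).symm
  · subst heq
    have hij : i ≠ j := fun h => hne (by rw [h])
    rcases lt_or_gt_of_ne hij with hij' | hij'
    · have hs : peV ptab i ≤ peU ptab j := by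
        have := chainOK_sorted hpchain (i : ℕ) (j : ℕ) hij' j.isLt
        unfold peV peU; exact_mod_cast this
      have h : 1 / ((m : ℝ) + peU ptab j) ≤ 1 / ((m : ℝ) + peV ptab i) := one_div_le_one_div_of_le hVi (by linarith)
      exact (windowPrimes_disjoint_of_le hAj hAi h n).symm
    · have hs : peV ptab j ≤ peU ptab i := by
        have := chainOK_sorted hpchain (j : ℕ) (i : ℕ) hij' i.isLt
        unfold peV peU; exact_mod_cast this
      have h : 1 / ((m : ℝ) + peU ptab i) ≤ 1 / ((m : ℝ) + peV ptab j) := one_div_le_one_div_of_le hVj (by linarith)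
      exact windowPrimes_disjoint_of_le hAi hAj h n
  · have h1 : (m' : ℝ) + 1 ≤ m := by exact_mod_cast hgt
    have h : 1 / ((m : ℝ) + peU ptab i) ≤ 1 / ((m' : ℝ) + peV ptab j) := one_div_le_one_div_of_le hVj (by linarith)
    exact windowPrimes_disjoint_of_le hAi hAj h n

/-- A periodic window ends below `θ = 1/m₁`: `1/(m + u) ≤ 1/m₁` for `m ≥ m₁ ≥ 1`, `u > 0`. -/
theorem perWin_right_le {ok : WinEntry → Bool} {NT : ℕ} (hps : PSound ok NT) (hpok : ptab.all ok = true) (hm₁ : 1 ≤ m₁) {m : ℕ}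
    (hm : m₁ ≤ m) (i : Fin ptab.length) : 1 / ((m : ℝ) + peU ptab i) ≤ 1 / (m₁ : ℝ) := by
  obtain ⟨hui, -, -⟩ := pe_hyp hps hpok i (Finset.mem_univ _)
  have h0 : (0 : ℝ) < m₁ := by exact_mod_cast hm₁
  have h1 : (m₁ : ℝ) ≤ m := by exact_mod_cast hm
  exact one_div_le_one_div_of_le h0 (by linarith)

/-! ### The combined atlas `Φ_K · Φ_tab · perFactor` -/

variable (tab ptab m₁)

/-- Index type of the combined atlas: (big-prime ⊕ table) windows, then (periodic entry, shift) windows. -/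
abbrev PIdx := (Fin 4 ⊕ Fin tab.length) ⊕ (Fin ptab.length × ℕ)

/-- Left endpoints. -/
def yA : PIdx tab ptab → ℝ := Sum.elim (cAT tab) (fun q => 1 / ((q.2 : ℝ) + peV ptab q.1))

/-- Right endpoints. -/
def yB : PIdx tab ptab → ℝ := Sum.elim (cBT tab) (fun q => 1 / ((q.2 : ℝ) + peU ptab q.1))

/-- Weights. -/
def yw : PIdx tab ptab → ℕ := Sum.elim (cwT tab) (fun q => peW ptab q.1)

/-- The index set at `n`: all table windows, and the periodic windows of the shifts `m₁ ≤ m ≤ Kp(n)`. -/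
def yS (n : ℕ) : Finset (PIdx tab ptab) :=
  (Finset.univ : Finset (Fin 4 ⊕ Fin tab.length)).disjSum ((Finset.univ : Finset (Fin ptab.length)) ×ˢ Finset.Ico m₁ (Kp n + 1))

/-- **The combined factor** `Φ_K · Φ_tab · perFactor`. -/
def corrP (n : ℕ) : ℕ := corrT tab n * perFactor ptab m₁ n

/-- **The multiplier of the two tables**: `kMP n = kM0 n / (Φ_K Φ_tab perFactor)` (`= kMT tab n / perFactor`, `kMP_eq`). -/
def kMP (n : ℕ) : ℚ := kM0 n / (corrP tab ptab m₁ n : ℚ)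

/-- `kMP = kMT / perFactor`. -/
theorem kMP_eq (n : ℕ) : kMP tab ptab m₁ n = kMT tab n / (perFactor ptab m₁ n : ℚ) := by
  unfold kMP kMT corrP; push_cast; rw [div_div]

/-- The periodic factor IS an atlas product over (entry, shift). -/
theorem perFactor_eq_multiWindowProd (n : ℕ) :
    perFactor ptab m₁ n = multiWindowProd ((Finset.univ : Finset (Fin ptab.length)) ×ˢ Finset.Ico m₁ (Kp n + 1))
      (fun q => 1 / ((q.2 : ℝ) + peV ptab q.1)) (fun q => 1 / ((q.2 : ℝ) + peU ptab q.1)) (fun q => peW ptab q.1) n := by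
  unfold perFactor stepFactorTrunc fracProdTrunc fracWindow multiWindowProd
  rw [Finset.prod_product]
  exact prod_congr rfl fun i _ => (Finset.prod_pow _ _ _).symm

/-- The combined factor IS the atlas product over `yS`. -/
theorem corrP_eq (n : ℕ) : corrP tab ptab m₁ n = multiWindowProd (yS tab ptab m₁ n) (yA tab ptab) (yB tab ptab) (yw tab ptab) n := by
  unfold corrP
  rw [perFactor_eq_multiWindowProd]
  unfold corrT multiWindowProd yS
  rw [Finset.prod_disjSum]
  simp only [yA, yB, yw, Sum.elim_inl, Sum.elim_inr]

variable {tab ptab m₁}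

/-- Membership of a periodic index: `m₁ ≤ m ≤ Kp(n)`. -/
theorem mem_yS_inr {n : ℕ} {i : Fin ptab.length} {m : ℕ} (h : (Sum.inr (i, m) : PIdx tab ptab) ∈ yS tab ptab m₁ n) :
    m₁ ≤ m ∧ m ≤ Kp n := by
  unfold yS at h
  rw [Finset.inr_mem_disjSum, Finset.mem_product, Finset.mem_Ico] at h
  exact ⟨h.2.1, Nat.le_of_lt_succ h.2.2⟩

/-- Every table window starts at or above `θ = 1/m₁` (`headGE` for the table, `38 ≥ 1 ≥ 1/m₁` for the big-prime windows). -/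
theorem yA_inl_ge (hchain : chainOK tab = true) (hm₁ : 1 ≤ m₁) (hhead : headGE m₁ tab = true) (a : Fin 4 ⊕ Fin tab.length) :
    1 / (m₁ : ℝ) ≤ yA tab ptab (Sum.inl a) := by
  have h0 : (0 : ℝ) < m₁ := by exact_mod_cast hm₁
  have h1 : 1 / (m₁ : ℝ) ≤ 1 := by
    rw [div_le_one h0]; exact_mod_cast hm₁
  rcases a with a | a
  · have hAa : (38 : ℝ) ≤ AwK a := by fin_cases a <;> simp [AwK] <;> norm_num
    simp only [yA, Sum.elim_inl, cAT]
    linarith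
  · have h := tA_ge_of_headGE hchain hhead a
    simp only [yA, Sum.elim_inl, cAT, Sum.elim_inr]
    have h' : (((1 : ℚ) / m₁ : ℚ) : ℝ) ≤ ((tA tab a : ℚ) : ℝ) := by exact_mod_cast h
    have h'' : (((1 : ℚ) / m₁ : ℚ) : ℝ) = 1 / (m₁ : ℝ) := by push_cast; rfl
    rw [h''] at h'
    exact h'

/-- **The combined windows are pairwise disjoint.** -/
theorem yS_disjoint {ok : WinEntry → Bool} {NT : ℕ} (hs : SoundChecker ok NT) (hok : tab.all ok = true) (hchain : chainOK tab = true)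
    {pok : WinEntry → Bool} {NTp : ℕ} (hps : PSound pok NTp) (hpok : ptab.all pok = true) (hpchain : chainOK ptab = true)
    (hm₁ : 1 ≤ m₁) (hhead : headGE m₁ tab = true) (n : ℕ) :
    ∀ x ∈ yS tab ptab m₁ n, ∀ y ∈ yS tab ptab m₁ n, x ≠ y →
      Disjoint (windowPrimes (yA tab ptab x) (yB tab ptab x) n) (windowPrimes (yA tab ptab y) (yB tab ptab y) n) := by
  rintro (a | ⟨i, m⟩) ha (b | ⟨j, m'⟩) hb hne
  · exact combined_disjointT hs hok hchain n a (Finset.mem_univ _) b (Finset.mem_univ _) (fun h => hne (by rw [h]))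
  · obtain ⟨hm1, -⟩ := mem_yS_inr hb
    have hA : 1 / ((m' : ℝ) + peU ptab j) ≤ yA tab ptab (Sum.inl a) :=
      (perWin_right_le hps hpok hm₁ hm1 j).trans (yA_inl_ge hchain hm₁ hhead a)
    have h0 : (0 : ℝ) ≤ yA tab ptab (Sum.inl a) := (cAT_le_cBT hs hok a (Finset.mem_univ _)).1
    obtain ⟨huj, huvj, -⟩ := pe_hyp hps hpok j (Finset.mem_univ _)
    have hm'0 : (0 : ℝ) ≤ m' := Nat.cast_nonneg m'
    have h0' : (0 : ℝ) ≤ 1 / ((m' : ℝ) + peV ptab j) := (one_div_pos.2 (by linarith)).le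
    exact (windowPrimes_disjoint_of_le h0' h0 hA n).symm
  · obtain ⟨hm1, -⟩ := mem_yS_inr ha
    have hA : 1 / ((m : ℝ) + peU ptab i) ≤ yA tab ptab (Sum.inl b) :=
      (perWin_right_le hps hpok hm₁ hm1 i).trans (yA_inl_ge hchain hm₁ hhead b)
    have h0 : (0 : ℝ) ≤ yA tab ptab (Sum.inl b) := (cAT_le_cBT hs hok b (Finset.mem_univ _)).1
    obtain ⟨hui, huvi, -⟩ := pe_hyp hps hpok i (Finset.mem_univ _)
    have hm0 : (0 : ℝ) ≤ m := Nat.cast_nonneg m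
    have h0' : (0 : ℝ) ≤ 1 / ((m : ℝ) + peV ptab i) := (one_div_pos.2 (by linarith)).le
    exact windowPrimes_disjoint_of_le h0' h0 hA n
  · have hne' : (i, m) ≠ (j, m') := fun h => hne (by rw [h])
    exact perWin_disjoint hps hpok hpchain hne' n

/-- **`0 < kMP n`, `kMP n · P_n ∈ ℤ`, `kMP n · Q(a·n) ∈ ℤ`** for `n ≥ NT, NTp` (`RayKernel.atlas_ints` over the combined atlas: `cert_bC1` on the
big-prime windows, the window checker on the table, the periodic checker at the shift `m` on the periodic windows). -/
theorem kMP_ints {ok : WinEntry → Bool} {NT : ℕ} (hs : SoundChecker ok NT) (hNT : 1 ≤ NT) (hok : tab.all ok = true)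
    (hchain : chainOK tab = true) {pok : WinEntry → Bool} {NTp : ℕ} (hps : PSound pok NTp) (hpok : ptab.all pok = true)
    (hpchain : chainOK ptab = true) (hm₁ : 1 ≤ m₁) (hhead : headGE m₁ tab = true) {n : ℕ} (hn : NT ≤ n) (hnp : NTp ≤ n) :
    0 < kMP tab ptab m₁ n ∧ (∃ z : ℤ, kMP tab ptab m₁ n * c1P n = z) ∧ (∃ z : ℤ, kMP tab ptab m₁ n * (c1Q n : ℚ) = z) := by
  classical
  have hn1 : 1 ≤ n := le_trans hNT hn
  have h := atlas_ints (yS tab ptab m₁ n) (yA tab ptab) (yB tab ptab) (yw tab ptab) n (sharpAdmissible_bC1 hn1)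
    (sharpAdmissible_bC1' hn1) (bn0_bC1' n) (rhoOf_aC1_ne_zero n) (fun x hx p hp => ?_)
    (yS_disjoint hs hok hchain hps hpok hpchain hm₁ hhead n)
  · obtain ⟨h0, hP, hQ⟩ := h
    have hc : (corrP tab ptab m₁ n : ℚ) = (multiWindowProd (yS tab ptab m₁ n) (yA tab ptab) (yB tab ptab) (yw tab ptab) n : ℚ) := by
      exact_mod_cast corrP_eq tab ptab m₁ n
    refine ⟨?_, ?_, ?_⟩
    · unfold kMP kM0; rw [hc]; exact h0
    · unfold kMP kM0 c1P; rw [hc]; exact hP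
    · unfold kMP kM0; rw [hc, c1Q_eq_wedge hn1]; exact hQ
  · rcases x with (a | a) | ⟨i, m⟩
    · simp only [yA, yB, yw, Sum.elim_inl, cAT, cBT, cwT] at hp ⊢
      obtain ⟨hpr, hlo, hhi, hk⟩ := windowK_prime hp
      exact cert_bC1 hn1 hpr hlo hhi hk
    · simp only [yA, yB, yw, Sum.elim_inl, cAT, cBT, cwT, Sum.elim_inr] at hp ⊢
      exact (hs _ (getElem_all hok a a.isLt)).2 n hn p hp
    · obtain ⟨hm1, hm2⟩ := mem_yS_inr hx
      simp only [yA, yB, yw, Sum.elim_inr] at hp ⊢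
      unfold peU peV at hp
      exact (hps _ (getElem_all hpok (i : ℕ) i.isLt)).2 n hnp m (le_trans hm₁ hm1) hm2 p hp

/-- **Size of the multiplier of the two tables**: for every `ε > 0`, eventually `kMP n ≤ e^{(359.4247 − R − perRate + ε)·n}`. -/
theorem eventually_kMP_le_exp {ok : WinEntry → Bool} {NT : ℕ} (hs : SoundChecker ok NT) (hok : tab.all ok = true) {R : ℚ}
    (hrate : (tab.map fun e => (e.2.2.1 : ℚ) * (e.2.1 - e.1)).sum = R) {pok : WinEntry → Bool} {NTp : ℕ} (hps : PSound pok NTp)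
    (hpok : ptab.all pok = true) (m₁ : ℕ) {ε : ℝ} (hε : 0 < ε) :
    ∀ᶠ n : ℕ in atTop, ((kMP tab ptab m₁ n : ℚ) : ℝ) ≤ Real.exp ((((3594247 / 10000 - R : ℚ) : ℝ) - perRate ptab m₁ + ε) * n) := by
  have hε2 : 0 < ε / 2 := by positivity
  filter_upwards [eventually_kMT_le_exp hs hok hrate hε2, eventually_exp_le_perFactor (m₁ := m₁) hps hpok hε2] with n hT hper
  have htpos : (0 : ℝ) < (perFactor ptab m₁ n : ℕ) := by exact_mod_cast perFactor_pos n
  have hcast : ((kMP tab ptab m₁ n : ℚ) : ℝ) = ((kMT tab n : ℚ) : ℝ) / ((perFactor ptab m₁ n : ℕ) : ℝ) := by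
    rw [kMP_eq]; push_cast; rfl
  rw [hcast]
  calc ((kMT tab n : ℚ) : ℝ) / ((perFactor ptab m₁ n : ℕ) : ℝ)
      ≤ Real.exp ((((3594247 / 10000 - R : ℚ) : ℝ) + ε / 2) * n) / ((perFactor ptab m₁ n : ℕ) : ℝ) :=
        div_le_div_of_nonneg_right hT htpos.le
    _ ≤ Real.exp ((((3594247 / 10000 - R : ℚ) : ℝ) + ε / 2) * n) / Real.exp ((perRate ptab m₁ - ε / 2) * n) :=
        div_le_div_of_nonneg_left (Real.exp_pos _).le (Real.exp_pos _) hper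
    _ = Real.exp ((((3594247 / 10000 - R : ℚ) : ℝ) - perRate ptab m₁ + ε) * n) := by
        rw [← Real.exp_sub]; ring_nf

/-- **THE EXPONENT OF A WINDOW TABLE PLUS A PERIODIC TABLE** (hypothesis-free once both checkers' soundness is supplied — windows:
`soundChecker_entryOK` etc.; periodic: `psound_brick`, `psound_class` under fam-rv's periodic window theorems, `psound_or`).  If `tab.all ok`,
`chainOK tab`, rate `R`, `headGE m₁ tab` (`m₁ ≥ 1`); `ptab.all pok`, `chainOK ptab`, `Rp ≤ Σ pterm m₁` (decidable); and `γ ≥ 0` satisfies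
`γ·((359.4247 − R − Rp + 0.01) + 114336 / 625) < 914687 / 5000 − (-691961 / 10000)`, then eventually `|ζ(5) − P_n/Q(a·n)| < 1/q_n^γ` with the
INTEGERS `p_n = kMP n·P_n`, `q_n = kMP n·|Q(a·n)| ≥ 1`.  No irrationality content (`γ < 1` in every use). -/
theorem c1_exponent_of_tables {ok : WinEntry → Bool} {NT : ℕ} (hs : SoundChecker ok NT) (hNT : 1 ≤ NT)
    (hok : tab.all ok = true) (hchain : chainOK tab = true) (hm₁ : 1 ≤ m₁) (hhead : headGE m₁ tab = true) {R : ℚ}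
    (hrate : (tab.map fun e => (e.2.2.1 : ℚ) * (e.2.1 - e.1)).sum = R)
    {pok : WinEntry → Bool} {NTp : ℕ} (hps : PSound pok NTp) (hpok : ptab.all pok = true) (hpchain : chainOK ptab = true)
    {Rp : ℚ} (hprate : Rp ≤ (ptab.map (pterm m₁)).sum) {γ : ℝ} (hγ0 : 0 ≤ γ)
    (hγ : γ * ((((3594247 / 10000 - R - Rp + 1 / 100 : ℚ)) : ℝ) + 114336 / 625) < 914687 / 5000 - (-691961 / 10000)) :
    ∀ᶠ n : ℕ in atTop, ∃ p : ℤ, ∃ q : ℕ, 1 ≤ q ∧ (q : ℚ) = kMP tab ptab m₁ n * |(c1Q n : ℚ)| ∧ (p : ℚ) = kMP tab ptab m₁ n * c1P n ∧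
      |zetaValue 5 - (c1P n : ℝ) / (c1Q n : ℝ)| < 1 / (q : ℝ) ^ γ := by
  have hRp : ((Rp : ℚ) : ℝ) ≤ perRate ptab m₁ :=
    le_trans (by exact_mod_cast hprate) (perRate_ge_listSum hps hpok hm₁)
  have hq : ((((3594247 / 10000 - R - Rp + 1 / 100 : ℚ)) : ℝ)) = (((3594247 / 10000 - R : ℚ)) : ℝ) - ((Rp : ℚ) : ℝ) + 1 / 100 := by
    push_cast; ring
  rw [hq] at hγ
  refine c1_exponent_rat (lam := (((3594247 / 10000 - R : ℚ)) : ℝ) - ((Rp : ℚ) : ℝ) + 1 / 100) (kMP tab ptab m₁)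
    (fun ε hε => ?_) hγ0 hγ
  filter_upwards [eventually_kMP_le_exp hs hok hrate hps hpok m₁ hε, eventually_ge_atTop (max NT NTp)] with n hn hnN
  obtain ⟨h0, hP, hQ⟩ := kMP_ints hs hNT hok hchain hps hpok hpchain hm₁ hhead (le_trans (le_max_left _ _) hnN)
    (le_trans (le_max_right _ _) hnN)
  refine ⟨h0, hP, hQ, hn.trans ?_⟩
  apply Real.exp_le_exp.2
  have hn0 : (0 : ℝ) ≤ n := Nat.cast_nonneg n
  nlinarith [hRp, hε]

end Summit.KontsevichZagierPeriods.Zeta5Search.RayC1
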